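import Mathlib
import Literature.Computability.AlgebraicComplexity.Apolarity
import Literature.Computability.AlgebraicComplexity.ApolarityAction
import Literature.Computability.AlgebraicComplexity.LinSubst
import Literature.Computability.AlgebraicComplexity.OrbitClosure
import Summits.ValiantsHypothesis.ValiantsHypothesis.Theorems.BorderApolarityToricFixedPointsToricLimitIsInitialAux1
import Summits.ValiantsHypothesis.ValiantsHypothesis.Theorems.BorderApolarityFixedWitnessObstructionQPKuratowskiSubmodule

/-!
# Border apolarity, support item `BorelFixedBorderApolarity` — translating border-apolar limits

Route `ValiantsHypothesis/BorderApolarity`, support item `stmt-ValiantsHypothesis-5781`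
(`Summit.ValiantsHypothesis.ValiantsHypothesis.Theses.BorderApolarity.BorelFixedBorderApolarity`),
helper file 1: the set
`Y = {J : J = lim_t Ann(P_t) degree-wise (P_t ∈ GL · det_m), J_k ⌟ pp = 0 (k ≤ m)}`
of border-apolar limits inside the annihilator of the padded permanent `pp` is stable under every
invertible substitution `A` with `A · pp = c • pp`, `c ≠ 0`:
`J ↦ {D : Aᵀ D ∈ J}` is the limit of `Ann(A · P_t)` (`bfba_isBorderApolarLimit_translate`,
transport of annihilators `Ann(A · f) = {D : Aᵀ D ∈ Ann f}` plus coefficientwise continuity of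
`linSubst` on degree-`k` forms) and still kills `pp` (`bfba_translate`).  Also: substitutions that
fix the "own" variables of `pp` fix `pp` (`bfba_linSubst_paddedPerPoly_eq_self`), and torus
substitutions act on a weighted homogeneous polynomial by a scalar (`bfba_linSubst_torus_of_weight`).
All folklore linear algebra (Buczyńska–Buczyński 2021 §3: `GL`-equivariance of apolarity).
-/

open MvPolynomial Filter
open scoped BigOperators Matrix Topology
open Literature.Computability.AlgebraicComplexity
open Summit.ValiantsHypothesis.ValiantsHypothesis.Theorems.BorderApolarityToricFixedPoints
  (tli_tendsto_coeffVec_linSubst tli_coeff_linSubst_torus)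
open Summit.ValiantsHypothesis.ValiantsHypothesis.Theorems.BorderApolarityFixedWitnessObstructionQP
  (mem_homogeneousSubmodule_of_tendsto)

namespace Summit.ValiantsHypothesis.ValiantsHypothesis.Theorems.BorderApolarityBorelFixedBorderApolarity

set_option linter.dupNamespace false

section General

variable {σ : Type} [Fintype σ] [DecidableEq σ]

/-- `linSubst A⁻¹ (linSubst A p) = p` for invertible `A`. [folklore] -/
theorem bfba_linSubst_inv_linSubst (A : Matrix σ σ ℂ) (hA : IsUnit A.det) (p : MvPolynomial σ ℂ) :
    linSubst σ ℂ A⁻¹ (linSubst σ ℂ A p) = p := by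
  rw [← AlgHom.comp_apply, ← linSubst_mul, Matrix.nonsing_inv_mul A hA, linSubst_one,
    AlgHom.id_apply]

/-- `linSubst A (linSubst A⁻¹ p) = p` for invertible `A`. [folklore] -/
theorem bfba_linSubst_linSubst_inv (A : Matrix σ σ ℂ) (hA : IsUnit A.det) (p : MvPolynomial σ ℂ) :
    linSubst σ ℂ A (linSubst σ ℂ A⁻¹ p) = p := by
  rw [← AlgHom.comp_apply, ← linSubst_mul, Matrix.mul_nonsing_inv A hA, linSubst_one,
    AlgHom.id_apply]

/-- Homogeneity is invariant under invertible substitutions. [folklore] -/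
theorem bfba_isHomogeneous_linSubst_iff (A : Matrix σ σ ℂ) (hA : IsUnit A.det)
    (p : MvPolynomial σ ℂ) (k : ℕ) :
    (linSubst σ ℂ A p).IsHomogeneous k ↔ p.IsHomogeneous k := by
  refine ⟨fun h => ?_, fun h => linSubst_isHomogeneous A h⟩
  have h2 := linSubst_isHomogeneous A⁻¹ h
  rwa [bfba_linSubst_inv_linSubst A hA] at h2

/-- **Transport of degree-`k` annihilators**: `D ∈ Ann_k(A · f) ↔ Aᵀ D ∈ Ann_k(f)` for
invertible `A`. [folklore] -/
theorem bfba_mem_annihilatorOfDegree_linSubst_iff (A : Matrix σ σ ℂ) (hA : IsUnit A.det)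
    (f D : MvPolynomial σ ℂ) (k : ℕ) :
    D ∈ annihilatorOfDegree (linSubst σ ℂ A f) k ↔
      linSubst σ ℂ Aᵀ D ∈ annihilatorOfDegree f k := by
  rw [mem_annihilatorOfDegree_iff, mem_annihilatorOfDegree_iff,
    apolarAction_linSubst_eq_zero_iff A hA,
    bfba_isHomogeneous_linSubst_iff Aᵀ (Matrix.isUnit_det_transpose A hA)]

/-- The orbit `GL · f` is stable under invertible substitutions. [folklore] -/
theorem bfba_linSubst_mem_glOrbit {f P : MvPolynomial σ ℂ} (hP : P ∈ glOrbit σ ℂ f)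
    (A : Matrix σ σ ℂ) (hA : IsUnit A.det) : linSubst σ ℂ A P ∈ glOrbit σ ℂ f := by
  obtain ⟨g, rfl⟩ := hP
  have hA' : A.det ≠ 0 := hA.ne_zero
  refine ⟨Matrix.GeneralLinearGroup.mkOfDetNeZero A hA' * g, ?_⟩
  simp only [map_mul, Module.End.mul_apply, linSubstRep_apply]
  rfl

/-- **Translating a border-apolar limit.**  If `J` is the degree-wise Kuratowski limit of
`Ann(P_t)` (degrees `≤ d`) and `A` is invertible, then `{D : Aᵀ D ∈ J}` is the limit of
`Ann(A · P_t)`: transport of annihilators and coefficientwise continuity of the substitutions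
`(Aᵀ)⁻¹`, `Aᵀ` on degree-`k` forms. [folklore] -/
theorem bfba_isBorderApolarLimit_translate (d : ℕ) (P : ℕ → MvPolynomial σ ℂ)
    (J : ℕ → Set (MvPolynomial σ ℂ)) (hJ : IsBorderApolarLimit d P J)
    (A : Matrix σ σ ℂ) (hA : IsUnit A.det) :
    IsBorderApolarLimit d (fun t => linSubst σ ℂ A (P t))
      (fun k => {D | linSubst σ ℂ Aᵀ D ∈ J k}) := by
  have hAT : IsUnit Aᵀ.det := Matrix.isUnit_det_transpose A hA
  refine ⟨?_, ?_⟩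
  · intro k hk D hD
    obtain ⟨Ds, hDs, hlim⟩ := hJ.exists_tendsto hk hD
    have hEhom : (linSubst σ ℂ Aᵀ D).IsHomogeneous k := hJ.isHomogeneous_of_mem hk hD
    have hDhom : D.IsHomogeneous k := (bfba_isHomogeneous_linSubst_iff Aᵀ hAT D k).1 hEhom
    refine ⟨fun t => linSubst σ ℂ Aᵀ⁻¹ (Ds t), fun t => ?_, ?_⟩
    · have h1 : linSubst σ ℂ Aᵀ⁻¹ (Ds t) ∈ annihilatorOfDegree (linSubst σ ℂ A (P t)) k := by
        rw [bfba_mem_annihilatorOfDegree_linSubst_iff A hA, bfba_linSubst_linSubst_inv Aᵀ hAT]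
        exact hDs t
      exact h1
    · have h2 := tli_tendsto_coeffVec_linSubst Aᵀ⁻¹ (fun t => (hDs t).1) hEhom hlim
      rwa [bfba_linSubst_inv_linSubst Aᵀ hAT] at h2
  · intro k hk D φ Ds hφ hDs hlim
    have hDs' : ∀ t, linSubst σ ℂ Aᵀ (Ds t) ∈ annihilatorOfDegree (P (φ t)) k := fun t =>
      (bfba_mem_annihilatorOfDegree_linSubst_iff A hA _ _ k).1 (hDs t)
    have hDhom : D.IsHomogeneous k := by
      have h := mem_homogeneousSubmodule_of_tendsto k (fun t => (mem_homogeneousSubmodule k _).2 (hDs t).1) hlim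
      exact (mem_homogeneousSubmodule k D).1 h
    have h2 := tli_tendsto_coeffVec_linSubst Aᵀ (fun t => (hDs t).1) hDhom hlim
    exact hJ.mem_of_tendsto hk hφ hDs' h2

/-- A torus substitution `diag(c^μ)` acts on a polynomial all of whose monomials have `μ`-weight
`ν₀` by the scalar `c^{ν₀}`. [folklore] -/
theorem bfba_linSubst_torus_of_weight (μ : σ → ℤ) (ν₀ : ℤ) {f : MvPolynomial σ ℂ}
    (hf : ∀ d ∈ f.support, Finsupp.weight μ d = ν₀) (c : ℂ) (hc : c ≠ 0) :
    linSubst σ ℂ (Matrix.diagonal fun i => c ^ μ i) f = c ^ ν₀ • f := by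
  ext d
  rw [tli_coeff_linSubst_torus c hc μ f d, coeff_smul, smul_eq_mul]
  by_cases hd : d ∈ f.support
  · rw [hf d hd]
  · rw [notMem_support_iff.1 hd, mul_zero, mul_zero]

end General

section Padded

variable {n m : ℕ} [NeZero m]

/-- A substitution whose columns at the "own" variables of the padded permanent (the padding
variable `(0,0)` and the block `{v | m-n ≤ v.1 ∧ m-n ≤ v.2}`) are the corresponding unit vectors
fixes the padded permanent. [folklore] -/
theorem bfba_linSubst_paddedPerPoly_eq_self (A : Matrix (Fin m × Fin m) (Fin m × Fin m) ℂ)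
    (hA : ∀ a : Fin m × Fin m, ((m - n ≤ (a.1 : ℕ) ∧ m - n ≤ (a.2 : ℕ)) ∨ a = (0, 0)) →
      ∀ b, A b a = if b = a then 1 else 0) :
    linSubst (Fin m × Fin m) ℂ A (paddedPerPoly ℂ n m) = paddedPerPoly ℂ n m := by
  have hX : ∀ a : Fin m × Fin m, ((m - n ≤ (a.1 : ℕ) ∧ m - n ≤ (a.2 : ℕ)) ∨ a = (0, 0)) →
      linSubst (Fin m × Fin m) ℂ A (X a) = X a := by
    intro a ha
    rw [linSubst_X, Finset.sum_eq_single a]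
    · rw [hA a ha a, if_pos rfl, one_smul]
    · intro b _ hb
      rw [hA a ha b, if_neg hb, zero_smul]
    · intro h
      exact absurd (Finset.mem_univ a) h
  unfold paddedPerPoly
  rw [map_mul, map_pow, hX (0, 0) (Or.inr rfl)]
  congr 1
  rw [← AlgHom.comp_apply]
  congr 1
  apply MvPolynomial.algHom_ext
  intro ij
  rw [AlgHom.comp_apply, rename_X, hX]
  exact Or.inl ⟨ij.1.2, ij.2.2⟩

/-- **`Y` is stable under translation.**  Let `J` be the degree-wise (`k ≤ m`) Kuratowski limit of
`Ann(P_t)` with `P_t ∈ GL · det_m` and `J_k ⌟ pp = 0` for `k ≤ m` (`pp` the padded permanent).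
For an invertible `A` with `A · pp = c • pp`, `c ≠ 0`, the translate `{D : Aᵀ D ∈ J}` is again
such a limit (along `A · P_t ∈ GL · det_m`) inside `Ann(pp)`:
`D ⌟ (A · pp) = 0 ↔ (Aᵀ D) ⌟ pp = 0`. [folklore] -/
theorem bfba_translate (P : ℕ → MvPolynomial (Fin m × Fin m) ℂ)
    (hP : ∀ t, P t ∈ glOrbit (Fin m × Fin m) ℂ (detPoly (Fin m) ℂ))
    (J : ℕ → Set (MvPolynomial (Fin m × Fin m) ℂ)) (hJ : IsBorderApolarLimit m P J)
    (hJpp : ∀ k ≤ m, ∀ D ∈ J k, apolarAction D (paddedPerPoly ℂ n m) = 0)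
    (A : Matrix (Fin m × Fin m) (Fin m × Fin m) ℂ) (hA : IsUnit A.det) (c : ℂ) (hc : c ≠ 0)
    (hApp : linSubst (Fin m × Fin m) ℂ A (paddedPerPoly ℂ n m) = c • paddedPerPoly ℂ n m) :
    (∀ t, linSubst (Fin m × Fin m) ℂ A (P t) ∈ glOrbit (Fin m × Fin m) ℂ (detPoly (Fin m) ℂ)) ∧
    IsBorderApolarLimit m (fun t => linSubst (Fin m × Fin m) ℂ A (P t))
      (fun k => {D | linSubst (Fin m × Fin m) ℂ Aᵀ D ∈ J k}) ∧
    (∀ k ≤ m, ∀ D ∈ {D | linSubst (Fin m × Fin m) ℂ Aᵀ D ∈ J k},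
      apolarAction D (paddedPerPoly ℂ n m) = 0) := by
  refine ⟨fun t => bfba_linSubst_mem_glOrbit (hP t) A hA,
    bfba_isBorderApolarLimit_translate m P J hJ A hA, ?_⟩
  intro k hk D hD
  have h1 : apolarAction (linSubst (Fin m × Fin m) ℂ Aᵀ D) (paddedPerPoly ℂ n m) = 0 :=
    hJpp k hk _ hD
  have h2 : apolarAction D (linSubst (Fin m × Fin m) ℂ A (paddedPerPoly ℂ n m)) = 0 :=
    (apolarAction_linSubst_eq_zero_iff A hA D _).2 h1
  rw [hApp, apolarAction_smul_right] at h2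
  exact (smul_eq_zero.1 h2).resolve_left hc

end Padded

end Summit.ValiantsHypothesis.ValiantsHypothesis.Theorems.BorderApolarityBorelFixedBorderApolarity
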